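import Summits.CriticalPhenomena.PercolationContinuityZ3.Theorems.Transplant.PlanarSkeletonFrmScaledDefs
import Summits.CriticalPhenomena.PercolationContinuityZ3.Theorems.Transplant.SiteTwoMaxArea
import Summits.CriticalPhenomena.PercolationContinuityZ3.Theorems.Transplant.CayleySkeletonFrmFrom
import HarnessLib

/-!
# `CayleyScaled` (I) — EVERY finite generating set: the datum, the max-area re-based chart `ψ` with exact `N`-steps, connectedness, and the
# constructor `ofRank`

builds on p205010 (kernel theorem, internal audit signed; external expert review pending) — nothing in this file uses p205010; nothing here is a
claim about the OPEN node `SamePDropOfSkeletonFrmScaled₁`.  Lane `prim-bschramm`, seat `prim-bschramm-p4` gen 16 (PART C3 of `P4-GENERAL.md` §38: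
ARBITRARY GENERATING SETS).  Helper file (`--supports stmt-CriticalPhenomena-4575 --as helper`).  Sequel: `CayleySkeletonScaledConn` ((κ′), the
skeleton `PlanarSkeletonFrmScaled (Cay(Γ;S))`, the conditional theorem).

WHAT.  Gen 13's `CayleyFrm₃` (INPUT = additive UNIT-RANGE chart with UNIT steps in `S` + f.g. kernel, modulo the universal one-type node U) does not
reach generating sets that are tall in every chart direction (`Cay(ℤ³; ±eᵢ, ±2eᵢ)`, `Cay(H₃(ℤ); a, b, a⁵)`, a generic finite symmetric `S ⊂ ℤ³`),
and coarsening the chart makes the carrier multi-type (excluded by N2-SCOPE (A4)/(R-6)).  Here the unit-range hypothesis is REMOVED at the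
price of two integers carried by the interface `PlanarSkeletonFrmScaled`:
* §1 **`CayleyScaled Γ S`** := an additive `φ : Γ → ℤ²`, `S` finite generating (`closure S = ⊤`, no symmetry or range condition), two elements of
  `S` with independent images (`rank_two`), and a finite kernel generating set `K` (`K_ker`, `K_gen`).  NOTHING ELSE.
* §2 the re-based chart `ψ := MaxArea.rebase u v ∘ φ` on a pair `(u, v)` of generator images of MAXIMAL AREA (file `SiteTwoMaxArea`): additive,
  `‖ψ(s)‖_∞ ≤ N := |det(u,v)|` on `S` (`abs_ψ_le`; `ψ` is `N`-Lipschitz along edges, `lip_adj`), generators `t₀, t₁ ∈ S` with `ψ(tᵢ) = N eᵢ`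
  EXACTLY (`ψ_gen'`), and `ker ψ = ker φ` (`ψ_eq_zero_iff`); §3 `Cay(Γ; S)` is connected (`S` generates); §4 constructor `ofRank` (independent
  images ANYWHERE in `Γ` suffice when `S` generates: otherwise all images are parallel).
[cite: BenjaminiSchramm1996, Conj. 4; §2 (Cayley graphs)] [cite: KozmaNitzan2024, §1 p. 2 (approach 1); §4 p. 16 (Lemma 8)]
[cite: MartineauTassion2017, §3.2 (good coordinates)]
-/

noncomputable section

namespace Summit.CriticalPhenomena.PercolationContinuityZ3.Theorems.Transplant

open SimpleGraph Walk Subgroup Literature.Probability.LatticeModels Literature.Probability.Percolation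
open Literature.Barriers.CriticalPhenomena (countable_of_connected_of_locallyFinite)
open scoped Classical

/-! ## §1 The datum -/

/-- **INPUT for an ARBITRARY finite generating set**: an additive `φ : Γ → ℤ²`, `S` generating, two generators with independent images, and a
finite generating set of `ker φ`.  No range condition on `φ(S)`, no unit steps, no symmetry, no cylinder condition.
[cite: BenjaminiSchramm1996, §2 (Cayley graphs); Conj. 4] [cite: KozmaNitzan2024, §4 p. 16 (Lemma 8)] -/
structure CayleyScaled (Γ : Type) [Group Γ] (S : Finset Γ) where
  /-- the chart -/
  φ : Γ → Site 2
  /-- additivity -/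
  map_mul : ∀ g h : Γ, φ (g * h) = φ g + φ h
  /-- `S` generates `Γ` -/
  gen : Subgroup.closure (S : Set Γ) = ⊤
  /-- two generators with linearly independent images -/
  rank_two : ∃ s ∈ S, ∃ s' ∈ S, MaxArea.det2 (φ s) (φ s') ≠ 0
  /-- a finite generating set of the kernel -/
  K : Finset Γ
  /-- the kernel generators lie in the kernel -/
  K_ker : ∀ k ∈ K, φ k = 0
  /-- the kernel generators generate the kernel -/
  K_gen : ∀ g : Γ, φ g = 0 → g ∈ Subgroup.closure (K : Set Γ)

namespace CayleyScaled

variable {Γ : Type} [Group Γ] {S : Finset Γ} (C : CayleyScaled Γ S)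

/-- `φ 1 = 0`. [folklore] -/
theorem φ_one : C.φ 1 = 0 := by
  have h := C.map_mul 1 1; rw [one_mul] at h; exact left_eq_add.1 h

/-- `φ (g⁻¹) = −φ g`. [folklore] -/
theorem φ_inv (g : Γ) : C.φ g⁻¹ = -C.φ g := by
  have h := C.map_mul g⁻¹ g; rw [inv_mul_cancel, φ_one] at h; exact eq_neg_of_add_eq_zero_left h.symm

/-! ## §2 The pair of maximal area and the re-based chart `ψ` -/

/-- A pair of generator images of maximal area exists. [folklore] -/
theorem maxPair_spec : ∃ u ∈ S.image C.φ, ∃ v ∈ S.image C.φ, MaxArea.det2 u v ≠ 0 ∧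
    ∀ x ∈ S.image C.φ, ∀ y ∈ S.image C.φ, |MaxArea.det2 x y| ≤ |MaxArea.det2 u v| :=
  MaxArea.exists_maxPair _ (by
    obtain ⟨s, hs, s', hs', h⟩ := C.rank_two
    exact ⟨C.φ s, Finset.mem_image_of_mem _ hs, C.φ s', Finset.mem_image_of_mem _ hs', h⟩)

/-- The first vector of the maximal pair. [folklore] -/
def u : Site 2 := Classical.choose C.maxPair_spec

/-- It is a generator image. [folklore] -/
theorem u_mem : C.u ∈ S.image C.φ := (Classical.choose_spec C.maxPair_spec).1

/-- The second vector of the maximal pair. [folklore] -/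
def v : Site 2 := Classical.choose (Classical.choose_spec C.maxPair_spec).2

/-- It is a generator image. [folklore] -/
theorem v_mem : C.v ∈ S.image C.φ := (Classical.choose_spec (Classical.choose_spec C.maxPair_spec).2).1

/-- The pair is independent. [folklore] -/
theorem det_ne : MaxArea.det2 C.u C.v ≠ 0 := (Classical.choose_spec (Classical.choose_spec C.maxPair_spec).2).2.1

/-- The pair maximises `|det|` over generator images. [folklore] -/
theorem det_max : ∀ x ∈ S.image C.φ, ∀ y ∈ S.image C.φ, |MaxArea.det2 x y| ≤ |MaxArea.det2 C.u C.v| :=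
  (Classical.choose_spec (Classical.choose_spec C.maxPair_spec).2).2.2

/-- **The scale `N = |det(u, v)|`.** [folklore] -/
def N : ℕ := (MaxArea.det2 C.u C.v).natAbs

/-- `(N : ℤ) = |det(u,v)|`. [folklore] -/
theorem N_cast : (C.N : ℤ) = |MaxArea.det2 C.u C.v| := Int.natCast_natAbs _

/-- `1 ≤ N`. [folklore] -/
theorem one_le_N : 1 ≤ C.N := Int.natAbs_pos.2 C.det_ne

/-- **The re-based chart `ψ = A ∘ φ`.** [cite: MartineauTassion2017, §3.2 (good coordinates)] -/
def ψ (g : Γ) : Site 2 := MaxArea.rebase C.u C.v (C.φ g)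

/-- `ψ` is additive. [folklore] -/
theorem ψ_mul (g h : Γ) : C.ψ (g * h) = C.ψ g + C.ψ h := by
  unfold ψ; rw [C.map_mul, MaxArea.rebase_add]

/-- `ψ 1 = 0`. [folklore] -/
theorem ψ_one : C.ψ 1 = 0 := by unfold ψ; rw [C.φ_one, MaxArea.rebase_zero]

/-- `ψ (g⁻¹) = −ψ g`. [folklore] -/
theorem ψ_inv (g : Γ) : C.ψ g⁻¹ = -C.ψ g := by unfold ψ; rw [C.φ_inv, MaxArea.rebase_neg]

/-- **`ker ψ = ker φ`** (the re-basing map is injective). [folklore] -/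
theorem ψ_eq_zero_iff (g : Γ) : C.ψ g = 0 ↔ C.φ g = 0 :=
  ⟨fun h => MaxArea.eq_zero_of_rebase_eq_zero C.det_ne h, fun h => by unfold ψ; rw [h, MaxArea.rebase_zero]⟩

/-- **Range `≤ N` on the generators.** [folklore] -/
theorem abs_ψ_le {s : Γ} (hs : s ∈ S) (i : Fin 2) : |C.ψ s i| ≤ C.N := by
  rw [N_cast]
  exact MaxArea.abs_rebase_le (C.det_max _ (Finset.mem_image_of_mem _ hs) _ C.v_mem) (C.det_max _ C.u_mem _ (Finset.mem_image_of_mem _ hs)) i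

/-- **`ψ` is `N`-Lipschitz along the edges of `Cay(Γ; S)`.** [folklore] -/
theorem lip_adj {a b : Γ} (h : (mulCayley (S : Set Γ)).Adj a b) (i : Fin 2) : |C.ψ a i - C.ψ b i| ≤ C.N := by
  rw [mulCayley_adj] at h
  obtain ⟨-, h | h⟩ := h
  · have e : C.ψ b = C.ψ a + C.ψ (a⁻¹ * b) := by rw [← ψ_mul, mul_inv_cancel_left]
    rw [e, Pi.add_apply, sub_add_cancel_left, abs_neg]
    exact C.abs_ψ_le (Finset.mem_coe.1 h) i
  · have e : C.ψ a = C.ψ b + C.ψ (b⁻¹ * a) := by rw [← ψ_mul, mul_inv_cancel_left]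
    rw [e, Pi.add_apply, add_sub_cancel_left]
    exact C.abs_ψ_le (Finset.mem_coe.1 h) i

/-- The generator realising the first vector of the pair. [folklore] -/
def t₀ : Γ := Classical.choose (Finset.mem_image.1 C.u_mem)

/-- It lies in `S`. [folklore] -/
theorem t₀_mem : C.t₀ ∈ S := (Classical.choose_spec (Finset.mem_image.1 C.u_mem)).1

/-- Its image is `u`. [folklore] -/
theorem φ_t₀ : C.φ C.t₀ = C.u := (Classical.choose_spec (Finset.mem_image.1 C.u_mem)).2

/-- The generator realising the second vector of the pair. [folklore] -/
def t₁ : Γ := Classical.choose (Finset.mem_image.1 C.v_mem)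

/-- It lies in `S`. [folklore] -/
theorem t₁_mem : C.t₁ ∈ S := (Classical.choose_spec (Finset.mem_image.1 C.v_mem)).1

/-- Its image is `v`. [folklore] -/
theorem φ_t₁ : C.φ C.t₁ = C.v := (Classical.choose_spec (Finset.mem_image.1 C.v_mem)).2

/-- **The step generator of direction `i`** (`t₀` or `t₁`). [folklore] -/
def gen' (i : Fin 2) : Γ := if i = 0 then C.t₀ else C.t₁

/-- The step generators lie in `S`. [folklore] -/
theorem gen'_mem (i : Fin 2) : C.gen' i ∈ S := by
  unfold gen'; split_ifs; exacts [C.t₀_mem, C.t₁_mem]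

/-- **EXACT STEPS: `ψ(tᵢ) = N eᵢ`.** [folklore] -/
theorem ψ_gen' (i : Fin 2) : C.ψ (C.gen' i) = Pi.single i (C.N : ℤ) := by
  fin_cases i
  · show MaxArea.rebase C.u C.v (C.φ C.t₀) = _
    rw [φ_t₀, MaxArea.rebase_left, ← N_cast]; rfl
  · show MaxArea.rebase C.u C.v (C.φ C.t₁) = _
    rw [φ_t₁, MaxArea.rebase_right, ← N_cast]; rfl

/-- The step generators are not the identity. [folklore] -/
theorem gen'_ne_one (i : Fin 2) : C.gen' i ≠ 1 := by
  intro h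
  have h1 := congrFun (C.ψ_gen' i) i
  rw [h, ψ_one, Pi.zero_apply, Pi.single_eq_same] at h1
  have := C.one_le_N
  omega

/-- Right multiplication by a step generator is an edge. [folklore] -/
theorem adj_gen' (i : Fin 2) (g : Γ) : (mulCayley (S : Set Γ)).Adj g (g * C.gen' i) :=
  CayCyl.adj_mul_of_mem S (Or.inl (C.gen'_mem i)) (C.gen'_ne_one i) g

/-- Right multiplication by the inverse of a step generator is an edge. [folklore] -/
theorem adj_gen'_inv (i : Fin 2) (g : Γ) : (mulCayley (S : Set Γ)).Adj g (g * (C.gen' i)⁻¹) :=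
  CayCyl.adj_mul_of_mem S (Or.inr (by rw [inv_inv]; exact C.gen'_mem i)) (inv_ne_one.2 (C.gen'_ne_one i)) g

/-- `ψ` after a forward step. [folklore] -/
theorem ψ_mul_gen' (g : Γ) (i : Fin 2) : C.ψ (g * C.gen' i) = C.ψ g + Pi.single i (C.N : ℤ) := by
  rw [ψ_mul, ψ_gen']

/-- `ψ` after a backward step. [folklore] -/
theorem ψ_mul_gen'_inv (g : Γ) (i : Fin 2) : C.ψ (g * (C.gen' i)⁻¹) = C.ψ g - Pi.single i (C.N : ℤ) := by
  rw [ψ_mul, ψ_inv, ψ_gen', sub_eq_add_neg]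

/-! ## §3 `Cay(Γ; S)` is connected -/

include C in
/-- **Every vertex is joined to `1`** (`S` generates; closure induction with left translates). [cite: BenjaminiSchramm1996, §2 (Cayley graphs)] -/
theorem reachable_one (g : Γ) : (mulCayley (S : Set Γ)).Reachable 1 g := by
  have hg : g ∈ Subgroup.closure (S : Set Γ) := by rw [C.gen]; exact Subgroup.mem_top g
  induction hg using Subgroup.closure_induction with
  | mem x hx =>
    by_cases hx1 : x = 1
    · rw [hx1]
    · have h := CayCyl.adj_mul_of_mem S (Or.inl (Finset.mem_coe.1 hx)) hx1 1
      rw [one_mul] at h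
      exact h.reachable
  | one => exact Reachable.refl 1
  | mul x y _ _ hx hy =>
    have h := hy.map (leftMulIso S x).toEmbedding.toHom
    have e1 : (leftMulIso S x).toEmbedding.toHom 1 = x := by show x * 1 = x; rw [mul_one]
    have e2 : (leftMulIso S x).toEmbedding.toHom y = x * y := rfl
    rw [e1, e2] at h
    exact hx.trans h
  | inv x _ hx =>
    have h := hx.map (leftMulIso S x⁻¹).toEmbedding.toHom
    have e1 : (leftMulIso S x⁻¹).toEmbedding.toHom 1 = x⁻¹ := by show x⁻¹ * 1 = x⁻¹; rw [mul_one]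
    have e2 : (leftMulIso S x⁻¹).toEmbedding.toHom x = 1 := by show x⁻¹ * x = 1; rw [inv_mul_cancel]
    rw [e1, e2] at h
    exact h.symm


/-! ## §4 Constructor: independent images anywhere in `Γ` -/

/-- Two vectors parallel to a nonzero vector are dependent. [folklore] -/
theorem det2_eq_zero_of_parallel {a b w : Site 2} (hw : w ≠ 0) (ha : MaxArea.det2 a w = 0) (hb : MaxArea.det2 b w = 0) :
    MaxArea.det2 a b = 0 := by
  by_contra hab
  apply hw
  funext i
  have hc := MaxArea.cramer a b w i
  rw [MaxArea.det2_swap b w, hb, ha, neg_zero, zero_mul, zero_mul, add_zero, mul_eq_zero] at hc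
  exact hc.resolve_left hab

/-- **Constructor `ofRank`**: when `S` generates, independent chart images of ANY two group elements give two GENERATORS with independent images
(otherwise all generator images, hence all images, are parallel). [folklore] -/
def ofRank (φ : Γ → Site 2) (map_mul : ∀ g h : Γ, φ (g * h) = φ g + φ h) (gen : Subgroup.closure (S : Set Γ) = ⊤)
    (rank : ∃ g h : Γ, MaxArea.det2 (φ g) (φ h) ≠ 0) (K : Finset Γ) (K_ker : ∀ k ∈ K, φ k = 0)
    (K_gen : ∀ g : Γ, φ g = 0 → g ∈ Subgroup.closure (K : Set Γ)) : CayleyScaled Γ S where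
  φ := φ
  map_mul := map_mul
  gen := gen
  rank_two := by
    by_contra hno
    push Not at hno
    obtain ⟨g, h, hgh⟩ := rank
    have φ_one : φ 1 = 0 := by have e := map_mul 1 1; rw [one_mul] at e; exact left_eq_add.1 e
    have φ_inv : ∀ x, φ x⁻¹ = -φ x := fun x => by
      have e := map_mul x⁻¹ x; rw [inv_mul_cancel, φ_one] at e; exact eq_neg_of_add_eq_zero_left e.symm
    -- every image is parallel to every generator image `w`
    have par : ∀ w : Site 2, (∀ s ∈ S, MaxArea.det2 (φ s) w = 0) → ∀ x : Γ, MaxArea.det2 (φ x) w = 0 := by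
      intro w hw x
      have hx : x ∈ Subgroup.closure (S : Set Γ) := by rw [gen]; exact Subgroup.mem_top x
      induction hx using Subgroup.closure_induction with
      | mem y hy => exact hw y (Finset.mem_coe.1 hy)
      | one => rw [φ_one, MaxArea.det2_zero_left]
      | mul y z _ _ hy hz => rw [map_mul, MaxArea.det2_add_left, hy, hz, add_zero]
      | inv y _ hy => rw [φ_inv, MaxArea.det2_neg_left, hy, neg_zero]
    by_cases hall : ∀ s ∈ S, φ s = 0
    · -- then `φ = 0`
      have h0 : ∀ x : Γ, φ x = 0 := by
        intro x
        have hx : x ∈ Subgroup.closure (S : Set Γ) := by rw [gen]; exact Subgroup.mem_top x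
        induction hx using Subgroup.closure_induction with
        | mem y hy => exact hall y (Finset.mem_coe.1 hy)
        | one => exact φ_one
        | mul y z _ _ hy hz => rw [map_mul, hy, hz, add_zero]
        | inv y _ hy => rw [φ_inv, hy, neg_zero]
      exact hgh (by rw [h0 g, MaxArea.det2_zero_left])
    · push Not at hall
      obtain ⟨s₀, hs₀, hw⟩ := hall
      have hpar : ∀ x : Γ, MaxArea.det2 (φ x) (φ s₀) = 0 := par (φ s₀) (fun s hs => hno s hs s₀ hs₀)
      exact hgh (det2_eq_zero_of_parallel hw (hpar g) (hpar h))
  K := K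
  K_ker := K_ker
  K_gen := K_gen


end CayleyScaled

end Summit.CriticalPhenomena.PercolationContinuityZ3.Theorems.Transplant

end
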